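import Literature.Analysis.FluidPDE.ElgindiBoundaryClassesZero
import Literature.Analysis.Calculus.JointSmoothnessPartialsWithin
import Mathlib.Analysis.Calculus.FDeriv.Extend
import Mathlib.Analysis.Calculus.IteratedDeriv.Lemmas
import Mathlib.MeasureTheory.Integral.DominatedConvergence
import Mathlib.MeasureTheory.Integral.IntervalIntegral.FundThmCalculus
import Mathlib.Analysis.SpecialFunctions.ExpDeriv
import HarnessLib

/-!
# Joint `C^∞` smoothness up to the angular boundary from the family of mixed partials
([Elgindi2021] §7.1 Proposition 7.1: the solution is smooth up to the boundary of the strip)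

Topic `Literature/Analysis/FluidPDE`. Support file (definitions with bodies and proved theorems, no
named facts) on the proof path of the named fact
`Literature.Analysis.FluidPDE.Elgindi.ElgindiGhoulMasmoudi2021_stabilityCore`
(`ElgindiStabilityDecomposition.lean`). T. M. Elgindi, Ann. of Math. 194 (2021) =
arXiv:1904.04795, §7.1 Proposition 7.1 (p. 19 of the held text).

`SlabFamily c g`: a family `g k l : ℝ → ℝ → ℝ` (think `∂_σ^l D_R^k χ`) whose boundary
extensions `bext (g k l)` are jointly continuous on the slab `(0,∞) × [0,c)`, with
`∂_σ g_{k,l} = g_{k,l+1}` and `R∂_R g_{k,l} = g_{k+1,l}` on the open part. Then, in the variables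
`(σ, s = log R)`, the function `(σ,s) ↦ g̃₀₀(eˢ, σ)` is `C^∞` on `[0,c) × ℝ` in Mathlib's within
sense (`SlabFamily.contDiffOn_slab`): the slices at `σ = 0` inherit their `s`-derivatives from the
interior by the fundamental theorem of calculus and dominated convergence
(`hasDerivAt_bextG_s`), the one-sided `σ`-derivatives at `σ = 0` come from the continuity of
`g_{k,l+1}` up to the boundary (`hasDerivWithinAt_bextG_sigma`), and the tree's
`contDiffOn_uncurry_of_mixed_partials_within` assembles joint smoothness. This is the input for
Seeley's extension across the boundary line.
-/

noncomputable section

open MeasureTheory Set Real Filter Function intervalIntegral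
open _root_.Topology
open scoped ContDiff

namespace Literature.Analysis.FluidPDE

namespace Elgindi

/-- **A family of mixed partials continuous up to `σ = 0`** with the derivative relations
`∂_σ g_{k,l} = g_{k,l+1}`, `R∂_R g_{k,l} = g_{k+1,l}` on `(0,∞) × (0,c)`. [folklore] -/
structure SlabFamily (c : ℝ) (g : ℕ → ℕ → ℝ → ℝ → ℝ) : Prop where
  pos : 0 < c
  cont : ∀ k l, ContinuousOn (bext (g k l)) (Ioi 0 ×ˢ Ico 0 c)
  dσ : ∀ k l, ∀ p ∈ Ioi (0:ℝ) ×ˢ Ioo (0:ℝ) c, HasDerivAt (fun σ => g k l p.1 σ) (g k (l + 1) p.1 p.2) p.2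
  dR : ∀ k l, ∀ p ∈ Ioi (0:ℝ) ×ˢ Ioo (0:ℝ) c, HasDerivAt (fun R => g k l R p.2) (g (k + 1) l p.1 p.2 / p.1) p.1

/-- The family in the variables `(σ, s = log R)`: `G_{k,l}(σ,s) = g̃_{k,l}(eˢ, σ)`. [folklore] -/
def bextG (g : ℕ → ℕ → ℝ → ℝ → ℝ) (k l : ℕ) (σ s : ℝ) : ℝ := bext (g k l) (Real.exp s, σ)

namespace SlabFamily

variable {c : ℝ} {g : ℕ → ℕ → ℝ → ℝ → ℝ} (h : SlabFamily c g)
include h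

/-- Joint continuity of `G_{k,l}` on `[0,c) × ℝ`. [folklore] -/
theorem continuousOn_bextG (k l : ℕ) : ContinuousOn (fun q : ℝ × ℝ => bextG g k l q.1 q.2) (Ico 0 c ×ˢ univ) := by
  refine (h.cont k l).comp ((Real.continuous_exp.comp continuous_snd).prodMk continuous_fst).continuousOn fun q hq => ?_
  exact ⟨Real.exp_pos _, hq.1⟩

/-- The values of the extension along `σ → 0⁺`. [folklore] -/
theorem tendsto_bext (k l : ℕ) {R : ℝ} (hR : 0 < R) :
    Tendsto (fun σ => g k l R σ) (𝓝[>] 0) (𝓝 (bext (g k l) (R, 0))) := by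
  have hp : ((R, (0:ℝ)) : ℝ × ℝ) ∈ Ioi 0 ×ˢ Ico 0 c := ⟨hR, left_mem_Ico.2 h.pos⟩
  have h1 : ContinuousWithinAt (bext (g k l)) (Ioi 0 ×ˢ Ico 0 c) (R, 0) := h.cont k l _ hp
  have hline : Tendsto (fun θ : ℝ => ((R, θ) : ℝ × ℝ)) (𝓝[>] 0) (𝓝[Ioi 0 ×ˢ Ico 0 c] (R, 0)) := by
    refine tendsto_nhdsWithin_iff.2 ⟨?_, ?_⟩
    · exact ((continuous_const.prodMk continuous_id).tendsto' 0 (R, 0) rfl).mono_left nhdsWithin_le_nhds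
    · filter_upwards [Ioo_mem_nhdsGT h.pos] with θ hθ
      exact ⟨hR, hθ.1.le, hθ.2⟩
  refine (h1.tendsto.comp hline).congr' ?_
  filter_upwards [self_mem_nhdsWithin] with θ hθ
  exact bext_of_pos (g k l) (p := (R, θ)) hθ

/-- A uniform bound for `bext (g k l)` on a compact sub-slab. [folklore] -/
theorem exists_bound (k l : ℕ) {a b c' : ℝ} (ha : 0 < a) (hc' : c' < c) :
    ∃ B, ∀ p ∈ Icc a b ×ˢ Icc 0 c', |bext (g k l) p| ≤ B := by
  have hK : IsCompact (Icc a b ×ˢ Icc (0:ℝ) c') := isCompact_Icc.prod isCompact_Icc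
  have hsub : Icc a b ×ˢ Icc (0:ℝ) c' ⊆ Ioi 0 ×ˢ Ico 0 c := fun p hp => ⟨ha.trans_le hp.1.1, hp.2.1, hp.2.2.trans_lt hc'⟩
  obtain ⟨B, hB⟩ := hK.exists_bound_of_continuousOn ((h.cont k l).mono hsub)
  exact ⟨B, fun p hp => by have := hB p hp; rwa [Real.norm_eq_abs] at this⟩

/-! ### `s`-derivatives: `∂_s G_{k,l} = G_{k+1,l}`, also on the boundary slice `σ = 0` -/

/-- Interior: `∂_s G_{k,l}(σ,·) = G_{k+1,l}(σ,·)` for `σ ∈ (0,c)`. [folklore] -/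
theorem hasDerivAt_bextG_s_pos (k l : ℕ) {σ : ℝ} (hσ : σ ∈ Ioo 0 c) (s : ℝ) :
    HasDerivAt (fun s' => bextG g k l σ s') (bextG g (k + 1) l σ s) s := by
  have hR : 0 < Real.exp s := Real.exp_pos s
  have hd := h.dR k l (Real.exp s, σ) ⟨hR, hσ⟩
  have hcomp := hd.comp s (Real.hasDerivAt_exp s)
  have e : ∀ s', bextG g k l σ s' = g k l (Real.exp s') σ := fun s' => bext_of_pos (g k l) (p := (Real.exp s', σ)) hσ.1
  have e1 : bextG g (k + 1) l σ s = g (k + 1) l (Real.exp s) σ := bext_of_pos (g (k + 1) l) (p := (Real.exp s, σ)) hσ.1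
  have hfun : (fun s' => bextG g k l σ s') = (fun R => g k l R σ) ∘ Real.exp := by funext s'; exact e s'
  rw [hfun, e1]
  refine hcomp.congr_deriv ?_
  field_simp

/-- Interior FTC: `G_{k,l}(σ,s') − G_{k,l}(σ,s) = ∫_s^{s'} G_{k+1,l}(σ,u) du` for `σ ∈ (0,c)`. [folklore] -/
theorem bextG_sub_eq_integral_pos (k l : ℕ) {σ : ℝ} (hσ : σ ∈ Ioo 0 c) (s s' : ℝ) :
    bextG g k l σ s' - bextG g k l σ s = ∫ u in s..s', bextG g (k + 1) l σ u := by
  have hcont : Continuous fun u => bextG g (k + 1) l σ u :=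
    (h.continuousOn_bextG (k + 1) l).comp_continuous (continuous_const.prodMk continuous_id) fun u => ⟨⟨hσ.1.le, hσ.2⟩, mem_univ _⟩
  exact (integral_eq_sub_of_hasDerivAt (fun u _ => h.hasDerivAt_bextG_s_pos k l hσ u) (hcont.intervalIntegrable _ _)).symm

/-- **Boundary FTC**: `G_{k,l}(0,s') − G_{k,l}(0,s) = ∫_s^{s'} G_{k+1,l}(0,u) du` (limit `σ → 0⁺` of
the interior identity, by dominated convergence). [folklore] -/
theorem bextG_sub_eq_integral_zero (k l : ℕ) (s s' : ℝ) :
    bextG g k l 0 s' - bextG g k l 0 s = ∫ u in s..s', bextG g (k + 1) l 0 u := by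
  -- both sides are limits as `σ → 0⁺` of the two sides of the interior identity
  have hL : Tendsto (fun σ => bextG g k l σ s' - bextG g k l σ s) (𝓝[>] 0) (𝓝 (bextG g k l 0 s' - bextG g k l 0 s)) := by
    have h1 : ∀ t, Tendsto (fun σ => bextG g k l σ t) (𝓝[>] 0) (𝓝 (bextG g k l 0 t)) := by
      intro t
      have ht := h.tendsto_bext k l (Real.exp_pos t)
      refine (ht.congr' ?_)
      filter_upwards [self_mem_nhdsWithin] with σ hσ
      exact (bext_of_pos (g k l) (p := (Real.exp t, σ)) hσ).symm
    exact (h1 s').sub (h1 s)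
  have hRHS : Tendsto (fun σ => ∫ u in s..s', bextG g (k + 1) l σ u) (𝓝[>] 0) (𝓝 (∫ u in s..s', bextG g (k + 1) l 0 u)) := by
    -- dominated convergence on `[s, s']` with a uniform bound on `exp([s,s']) × [0, c/2]`
    set a := Real.exp (min s s')
    set b := Real.exp (max s s')
    have ha : 0 < a := Real.exp_pos _
    have hc2 : c / 2 < c := by linarith [h.pos]
    obtain ⟨B, hB⟩ := h.exists_bound (k + 1) l (a := a) (b := b) (c' := c / 2) ha hc2
    have hmem : ∀ σ ∈ Ico (0:ℝ) (c / 2), ∀ u ∈ uIcc s s', ((Real.exp u, σ) : ℝ × ℝ) ∈ Icc a b ×ˢ Icc 0 (c / 2) := by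
      intro σ hσ u hu
      rw [uIcc, mem_Icc] at hu
      exact ⟨⟨Real.exp_le_exp.2 (by simpa using hu.1), Real.exp_le_exp.2 (by simpa using hu.2)⟩, hσ.1, hσ.2.le⟩
    have hcw : ContinuousWithinAt (fun σ => ∫ u in s..s', bextG g (k + 1) l σ u) (Ico 0 (c / 2)) 0 := by
      refine continuousWithinAt_of_dominated_interval (bound := fun _ => |B|) ?_ ?_ ?_ ?_
      · filter_upwards [self_mem_nhdsWithin] with σ hσ
        have hcu : ContinuousOn (fun u => bextG g (k + 1) l σ u) (uIcc s s') :=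
          (h.continuousOn_bextG (k + 1) l).comp (continuous_const.prodMk continuous_id).continuousOn
            fun u _ => ⟨⟨hσ.1, hσ.2.trans hc2⟩, mem_univ _⟩
        exact (hcu.mono uIoc_subset_uIcc).aestronglyMeasurable measurableSet_uIoc
      · filter_upwards [self_mem_nhdsWithin] with σ hσ
        refine ae_of_all _ fun u hu => ?_
        rw [Real.norm_eq_abs]
        exact (hB _ (hmem σ hσ u (uIoc_subset_uIcc hu))).trans (le_abs_self B)
      · exact intervalIntegrable_const
      · refine ae_of_all _ fun u hu => ?_
        have hq : (((0:ℝ), u) : ℝ × ℝ) ∈ Ico 0 c ×ˢ (univ : Set ℝ) := ⟨left_mem_Ico.2 h.pos, mem_univ _⟩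
        have hcq := h.continuousOn_bextG (k + 1) l _ hq
        have hpath : ContinuousWithinAt (fun σ : ℝ => ((σ, u) : ℝ × ℝ)) (Ico 0 (c / 2)) 0 := (continuous_id.prodMk continuous_const).continuousWithinAt
        have hmaps : MapsTo (fun σ : ℝ => ((σ, u) : ℝ × ℝ)) (Ico 0 (c / 2)) (Ico 0 c ×ˢ univ) := fun σ hσ => ⟨⟨hσ.1, hσ.2.trans hc2⟩, mem_univ _⟩
        exact ContinuousWithinAt.comp (f := fun σ : ℝ => ((σ, u) : ℝ × ℝ)) (x := 0) hcq hpath hmaps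
    have := hcw.tendsto
    -- `𝓝[>] 0 ≤ 𝓝[Ico 0 (c/2)] 0`
    have hle : 𝓝[>] (0:ℝ) ≤ 𝓝[Ico 0 (c / 2)] 0 := by
      rw [← nhdsWithin_Ioo_eq_nhdsGT (show (0:ℝ) < c / 2 by linarith [h.pos])]
      exact nhdsWithin_mono _ Ioo_subset_Ico_self
    exact this.mono_left hle
  have hEq : ∀ᶠ σ in 𝓝[>] (0:ℝ), bextG g k l σ s' - bextG g k l σ s = ∫ u in s..s', bextG g (k + 1) l σ u := by
    filter_upwards [Ioo_mem_nhdsGT h.pos] with σ hσ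
    exact h.bextG_sub_eq_integral_pos k l hσ s s'
  exact tendsto_nhds_unique (hL.congr' hEq) hRHS

/-- **`∂_s G_{k,l}(σ,·) = G_{k+1,l}(σ,·)` for every `σ ∈ [0,c)`** (boundary slice included). [folklore] -/
theorem hasDerivAt_bextG_s (k l : ℕ) {σ : ℝ} (hσ : σ ∈ Ico 0 c) (s : ℝ) :
    HasDerivAt (fun s' => bextG g k l σ s') (bextG g (k + 1) l σ s) s := by
  rcases hσ.1.lt_or_eq with hpos | hzero
  · exact h.hasDerivAt_bextG_s_pos k l ⟨hpos, hσ.2⟩ s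
  · subst hzero
    have hcont : Continuous fun u => bextG g (k + 1) l 0 u :=
      (h.continuousOn_bextG (k + 1) l).comp_continuous (continuous_const.prodMk continuous_id) fun u => ⟨left_mem_Ico.2 h.pos, mem_univ _⟩
    have hF : HasDerivAt (fun s' => ∫ u in s..s', bextG g (k + 1) l 0 u) (bextG g (k + 1) l 0 s) s :=
      integral_hasDerivAt_right (hcont.intervalIntegrable _ _) (hcont.stronglyMeasurableAtFilter _ _) hcont.continuousAt
    have hfun : (fun s' => bextG g k l 0 s') = fun s' => bextG g k l 0 s + ∫ u in s..s', bextG g (k + 1) l 0 u := by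
      funext s'
      have := h.bextG_sub_eq_integral_zero k l s s'
      linarith
    rw [hfun]
    exact hF.const_add _

/-- Iterated `s`-derivatives: `∂_s^j G_{k,l}(σ,·) = G_{k+j,l}(σ,·)`. [folklore] -/
theorem iteratedDeriv_bextG (j : ℕ) : ∀ (k l : ℕ) {σ : ℝ}, σ ∈ Ico 0 c →
    iteratedDeriv j (fun s => bextG g k l σ s) = fun s => bextG g (k + j) l σ s := by
  induction j with
  | zero => intro k l σ _; simp
  | succ j ih =>
    intro k l σ hσ
    rw [iteratedDeriv_succ', show (deriv fun s => bextG g k l σ s) = fun s => bextG g (k + 1) l σ s from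
      funext fun s => (h.hasDerivAt_bextG_s k l hσ s).deriv, ih (k + 1) l hσ]
    simp only [show k + 1 + j = k + (j + 1) by ring]

/-- **Every slice `s ↦ G_{k,l}(σ,s)` is `C^∞`**, `σ ∈ [0,c)`. [folklore] -/
theorem contDiff_bextG_slice (k l : ℕ) {σ : ℝ} (hσ : σ ∈ Ico 0 c) : ContDiff ℝ ∞ fun s => bextG g k l σ s := by
  refine contDiff_of_differentiable_iteratedDeriv fun m _ => ?_
  rw [h.iteratedDeriv_bextG m k l hσ]
  exact fun s => (h.hasDerivAt_bextG_s (k + m) l hσ s).differentiableAt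

/-! ### `σ`-derivatives within `[0,c)`: `∂_σ G_{k,l} = G_{k,l+1}` -/

/-- **`∂_σ G_{k,l}(·,s) = G_{k,l+1}(·,s)` within `[0,c)`**, one-sided at `σ = 0`. [folklore] -/
theorem hasDerivWithinAt_bextG_sigma (k l : ℕ) {σ : ℝ} (hσ : σ ∈ Ico 0 c) (s : ℝ) :
    HasDerivWithinAt (fun τ => bextG g k l τ s) (bextG g k (l + 1) σ s) (Ico 0 c) σ := by
  have hR : 0 < Real.exp s := Real.exp_pos s
  -- the interior derivative
  have hint : ∀ τ ∈ Ioo (0:ℝ) c, HasDerivAt (fun τ' => bextG g k l τ' s) (bextG g k (l + 1) τ s) τ := by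
    intro τ hτ
    have hd := h.dσ k l (Real.exp s, τ) ⟨hR, hτ⟩
    have hev : (fun τ' => bextG g k l τ' s) =ᶠ[𝓝 τ] fun τ' => g k l (Real.exp s) τ' := by
      filter_upwards [lt_mem_nhds hτ.1] with τ' hτ'
      exact bext_of_pos (g k l) (p := (Real.exp s, τ')) hτ'
    rw [show bextG g k (l + 1) τ s = g k (l + 1) (Real.exp s) τ from bext_of_pos (g k (l + 1)) (p := (Real.exp s, τ)) hτ.1]
    exact hd.congr_of_eventuallyEq hev
  rcases hσ.1.lt_or_eq with hpos | hzero
  · exact (hint σ ⟨hpos, hσ.2⟩).hasDerivWithinAt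
  · subst hzero
    -- one-sided derivative at `0` from continuity of `G_{k,l+1}` up to the boundary
    have hdiff : DifferentiableOn ℝ (fun τ => bextG g k l τ s) (Ioo 0 c) := fun τ hτ => (hint τ hτ).differentiableAt.differentiableWithinAt
    have hslice : ∀ m, ContinuousWithinAt (fun τ => bextG g k m τ s) (Ico 0 c) 0 := fun m => by
      have hq : (((0:ℝ), s) : ℝ × ℝ) ∈ Ico 0 c ×ˢ (univ : Set ℝ) := ⟨left_mem_Ico.2 h.pos, mem_univ _⟩
      exact ContinuousWithinAt.comp (f := fun τ : ℝ => ((τ, s) : ℝ × ℝ)) (x := 0) (h.continuousOn_bextG k m _ hq)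
        (continuous_id.prodMk continuous_const).continuousWithinAt fun τ hτ => ⟨hτ, mem_univ _⟩
    have hcont0 : ContinuousWithinAt (fun τ => bextG g k l τ s) (Ioo 0 c) 0 := (hslice l).mono Ioo_subset_Ico_self
    have hlim : Tendsto (fun τ => deriv (fun τ' => bextG g k l τ' s) τ) (𝓝[>] 0) (𝓝 (bextG g k (l + 1) 0 s)) := by
      have h1 : Tendsto (fun τ => bextG g k (l + 1) τ s) (𝓝[>] 0) (𝓝 (bextG g k (l + 1) 0 s)) := by
        have := (hslice (l + 1)).tendsto
        rw [← nhdsWithin_Ioo_eq_nhdsGT h.pos]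
        exact this.mono_left (nhdsWithin_mono _ Ioo_subset_Ico_self)
      refine h1.congr' ?_
      filter_upwards [Ioo_mem_nhdsGT h.pos] with τ hτ
      exact ((hint τ hτ).deriv).symm
    have hIci := hasDerivWithinAt_Ici_of_tendsto_deriv hdiff hcont0 (Ioo_mem_nhdsGT h.pos) hlim
    exact hIci.mono fun τ hτ => hτ.1

/-! ### Joint smoothness within the slab -/

/-- **`(σ,s) ↦ g̃₀₀(eˢ,σ)` is `C^∞` on `[0,c) × ℝ` in the within sense** (indeed every `G_{0,l}`). [folklore] -/
theorem contDiffOn_slab (l : ℕ) : ContDiffOn ℝ ∞ (fun q : ℝ × ℝ => bextG g 0 l q.1 q.2) (Ico 0 c ×ˢ univ) := by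
  -- the conversion between `iteratedFDeriv` and `iteratedDeriv` in one variable
  set e : ∀ k : ℕ, ℝ ≃ₗᵢ[ℝ] (ℝ [×k]→L[ℝ] ℝ) := fun k => ContinuousMultilinearMap.piFieldEquiv ℝ (Fin k) ℝ
  have hconv : ∀ (k : ℕ) (f : ℝ → ℝ) (x : ℝ), iteratedFDeriv ℝ k f x = e k (iteratedDeriv k f x) := fun k f x => by
    have := congrFun (iteratedFDeriv_eq_equiv_comp (𝕜 := ℝ) (n := k) (f := f)) x
    exact this
  set w : ℕ → ℝ → ℝ → ℝ := fun l σ s => bextG g 0 l σ s with hw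
  have key := Literature.Analysis.Calculus.contDiffOn_uncurry_of_mixed_partials_within (E := ℝ) (F := ℝ) (I := Ico 0 c)
    (convex_Ico 0 c) (uniqueDiffOn_Ico 0 c) (w := w) ?_ ?_ ?_ l
  · exact key
  · intro l σ hσ; exact h.contDiff_bextG_slice 0 l hσ
  · intro k l σ hσ x
    have e1 : ∀ τ ∈ Ico (0:ℝ) c, iteratedFDeriv ℝ k (w l τ) x = e k (bextG g k l τ x) := fun τ hτ => by
      rw [hconv, hw]; simp only; rw [h.iteratedDeriv_bextG k 0 l hτ]; simp
    have hd := h.hasDerivWithinAt_bextG_sigma k l hσ x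
    have hd' : HasDerivWithinAt (fun τ => e k (bextG g k l τ x)) (e k (bextG g k (l + 1) σ x)) (Ico 0 c) σ :=
      ((e k).toContinuousLinearEquiv.toContinuousLinearMap.hasFDerivAt).comp_hasDerivWithinAt σ hd
    have e2 : iteratedFDeriv ℝ k (w (l + 1) σ) x = e k (bextG g k (l + 1) σ x) := by
      rw [hconv, hw]; simp only; rw [h.iteratedDeriv_bextG k 0 (l + 1) hσ]; simp
    rw [e2]
    exact hd'.congr (fun τ hτ => e1 τ hτ) (e1 σ hσ)
  · intro k l
    have hc := h.continuousOn_bextG k l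
    have e1 : ∀ q ∈ Ico (0:ℝ) c ×ˢ (univ : Set ℝ), iteratedFDeriv ℝ k (w l q.1) q.2 = e k (bextG g k l q.1 q.2) := fun q hq => by
      rw [hconv, hw]; simp only; rw [h.iteratedDeriv_bextG k 0 l hq.1]; simp
    exact ((e k).continuous.comp_continuousOn hc).congr e1

end SlabFamily

end Elgindi

end Literature.Analysis.FluidPDE
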